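import Literature.Computability.Complexity.PolynomialEntropyApproximation
import Literature.Computability.MetaComplexity.SamplableMixtures
import Summits.PneNP.PneNP.Theorems.SzkEntropyPeaWorstToAvgOrbit
import HarnessLib

/-!
# Route SzkEntropy, crux `PeaWorstToAvg` (stmt-PneNP-10777): objects of the line `orbit-pair-rsr` (definitions + glue)

Objects posited by the line `orbit-pair-rsr` for the crux `SzkEntropy.PeaWorstToAvg` (skeleton
`Summits/PneNP/PneNP/Cruxes/PeaWorstToAvg/Lines/orbit-pair-rsr.lean`, whose registered stubs
`stub_transfer`, `stub_randClosure`, `stub_orbitKit`, `stub_adviceElim`, `stub_orbitRSR` are stated in exactly this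
vocabulary and namespace), landed verbatim from §1/§3 of that skeleton so that every stub proof can state its registered
signature by the same short names:

* `affOut`, `AffEquiv` — affine relabelling of output words and affine equivalence of sparse cubic maps on the same
  `s` variables (`Q = (B·+c) ∘ P ∘ (A·+b)`, `A ∈ GL_s(F₂)`, `B ∈ GL_m(F₂)`; Patarin's IP2S relation at equal formats);
* `OrbitSet`, `OrbitPair`, `Side`, `bySide` — the orbit instances of an explicit family `p = (pˢ)ₛ` at thresholds `k`,
  the ORBIT-PAIR promise problem of two families (YES = orbit of `p₁`, NO = orbit of `p₀`, same encoding as `PEA`),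
  its size slices, and the Boolean indexing of the pair;
* `IsPUniform`, `Separated` — `P`-uniformity of an explicit instance sequence and entropy separation across `k` from
  size `1` on;
* `OrbitKit` (+ `OrbitKit.law`, `OrbitKit.mix`) — a UNIFORM planted sampler of each orbit at size `n + 1` and an in-orbit
  re-randomiser `1/16`-close to the planted law (the object asserted by `stub_orbitKit`);
* glue (sorry-free, §3 of the skeleton): `AffEquiv.entropy_eq` (entropy is an orbit invariant), `orbitSet_yes_subset`,
  `orbitSet_no_subset`, `orbitPair_yes_le`, `orbitPair_no_le`, `orbitPair_polyTimeReducible_PEA` (`OrbitPair ≤ₚ PEA 3`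
  by the identity), `orbitPair_disjoint`, `side_one_subset_yes`, `side_zero_subset_no`, `OrbitKit.isPolySamplable_law`,
  `OrbitKit.isPolySamplable_mix`, `OrbitKit.law_false_support`, `OrbitKit.law_true_support`, `OrbitKit.mix_support`,
  and the sanity lemma `affEquiv_refl` (every map lies in its own orbit: the orbit sets are inhabited by the base points).

The uniform heuristic class `UHeurBPP` used by `stub_adviceElim` / `stub_orbitRSR` is NOT redeclared here: the line uses
`Summit.PneNP.PneNP.Cruxes.PeaWorstToAvg.DualModeCompile.UHeurBPP` (`SzkEntropyPeaWorstToAvgDualModeCompileDefs.lean`), so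
that the advice-elimination stub is literally the same proposition in both lines of this crux.
Sources: Dvir–Gutfreund–Rothblum–Vadhan, ICS 2011, §3 p. 6 and pp. 2–3 (PEA, changes of variables); J. Patarin,
EUROCRYPT 1996 (isomorphism of polynomials, IP2S); Bogdanov–Trevisan, FnT–TCS 2 (2006), Def. 2.1, 2.12–2.13;
Grochow–Qiao, SIAM J. Comput. 52 (2023) (tensor isomorphism; cubic-form equivalence).
-/

namespace Summit.PneNP.PneNP.Cruxes.PeaWorstToAvg.OrbitPairRsr

set_option linter.dupNamespace false -- `Summit.PneNP.PneNP.…`: summit = sub-problem name (D-0017 single-conjunct layout)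

open Literature.Computability.Complexity Literature.Computability.MetaComplexity
open _root_.Computability
open Summit.PneNP.PneNP.Theorems

/-! ### Affine equivalence of sparse cubic maps -/

/-- Affine relabelling of output words: `l ↦ B·v(l) + c` where `v(l) ∈ F₂^m` reads the first `m`
letters of `l` (default `0`), written back as a word of length `m`. [cite: Patarin1996, §2 (IP with two secrets)] -/
def affOut {m : ℕ} (B : Matrix (Fin m) (Fin m) (ZMod 2)) (c : Fin m → ZMod 2)
    (l : List (ZMod 2)) : List (ZMod 2) :=
  List.ofFn (B.mulVec (fun i : Fin m => l.getD i 0) + c)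

/-- Affine equivalence of sparse cubic maps on the same `s` variables (semantic, as functions
`F₂ˢ → F₂^m`, `m = P.length`): `Q = (B·+c) ∘ P ∘ (A·+b)` with `A ∈ GL_s(F₂)`, `B ∈ GL_m(F₂)`.
(Patarin's IP2S relation restricted to equal formats.) [cite: Patarin1996, §2 (IP with two secrets)] -/
def AffEquiv {s : ℕ} (P Q : PolyMapF2 s) : Prop :=
  ∃ (A : Matrix (Fin s) (Fin s) (ZMod 2)) (b : Fin s → ZMod 2)
    (B : Matrix (Fin P.length) (Fin P.length) (ZMod 2)) (c : Fin P.length → ZMod 2),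
    IsUnit A ∧ IsUnit B ∧ ∀ x : Fin s → ZMod 2, Q.eval x = affOut B c (P.eval (A.mulVec x + b))

/-! ### The orbit-pair promise problem -/

/-- The orbit instances of an explicit family `p = (pˢ)ₛ` with thresholds `k`: PEA instances
`⟨s, (q, j)⟩` with `s ≥ 1`, `j = k s`, `q` of syntactic degree `≤ 3` and affinely equivalent to `pˢ`.
[cite: DvirGutfreundRothblumVadhan2010, §3 p.6 and pp. 2–3 (changes of variables)] -/
def OrbitSet (p : (s : ℕ) → PolyMapF2 s) (k : ℕ → ℕ) : Set PEAInst :=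
  {I | 1 ≤ I.1 ∧ I.2.2 = k I.1 ∧ PolyMapF2.DegLE 3 I.2.1 ∧ AffEquiv (p I.1) I.2.1}

/-- **The orbit-pair promise problem** of two explicit cubic families: YES = orbit instances of `p₁`,
NO = orbit instances of `p₀` (same encoding as `PEA`, so that `OrbitPair ≤ₚ PEA 3` by the identity
once the pair is entropy-separated, `orbitPair_polyTimeReducible_PEA`). [cite: Patarin1996, §2 (IP with two secrets)] -/
noncomputable def OrbitPair (p₀ p₁ : (s : ℕ) → PolyMapF2 s) (k : ℕ → ℕ) : PromiseProblem :=
  PromiseProblem.ofEncoding PEAInst.encoding (OrbitSet p₁ k) (OrbitSet p₀ k)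

/-- The size-`s` slice of the orbit instances of `p`, as a language. [folklore] -/
def Side (p : (s : ℕ) → PolyMapF2 s) (k : ℕ → ℕ) (s : ℕ) : Set (List Bool) :=
  PEAInst.encoding.toLanguage {I | I ∈ OrbitSet p k ∧ I.1 = s}

/-- The two families of a pair, indexed by the answer bit (`false ↦ p₀`, `true ↦ p₁`). [folklore] -/
def bySide (p₀ p₁ : (s : ℕ) → PolyMapF2 s) : Bool → (s : ℕ) → PolyMapF2 s
  | false => p₀
  | true => p₁

/-- `P`-uniformity of an explicit instance sequence: `1ˢ ↦ ⟨s, (pˢ, k s)⟩` is in `FP`.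
[cite: AroraBarak2009, §6.2 (P-uniform families)] -/
def IsPUniform (p : (s : ℕ) → PolyMapF2 s) (k : ℕ → ℕ) : Prop :=
  ∃ f ∈ FP, ∀ s : ℕ, f (unaryEncodeNat s) = PEAInst.encoding.encode ⟨s, (p s, k s)⟩

/-- Entropy separation across the threshold from size `1` on (size `0` carries only entropy `0`;
triage r1 sharpening 1): `H(p₀ˢ) ≤ k s < k s + 1 ≤ H(p₁ˢ)` for all `s ≥ 1`.
[cite: DvirGutfreundRothblumVadhan2010, §3 p.6 (the promise of PEA)] -/
def Separated (p₀ p₁ : (s : ℕ) → PolyMapF2 s) (k : ℕ → ℕ) : Prop :=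
  ∀ s : ℕ, 1 ≤ s → (p₀ s).entropy ≤ k s ∧ (k s : ℝ) + 1 ≤ (p₁ s).entropy

/-! ### Orbit kits -/

/-- **Orbit kit** of a pair: a UNIFORM (honest polynomial coin budget — no `coinLen` advice) planted
sampler `samp b` of the size-`(n+1)` orbit of `p_b`, and an in-orbit re-randomiser `rer`, whose law
on any point of that orbit is `1/16`-close (one-sided, on every event) to the planted law.  Built in
`stub_orbitKit` from: canonical multilinear normal form of `(B·+c) ∘ q ∘ (A·+b)` in `FP`, and a
truncated-rejection sampler of `GL(F₂)` (law `(1-f)·U(GL) + f·δ_I`, `f ≤ 0.72^t`).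
[cite: BogdanovTrevisan2006, Def. 2.1 (samplable ensembles)] [cite: DvirGutfreundRothblumVadhan2010, pp. 2–3] -/
structure OrbitKit (p₀ p₁ : (s : ℕ) → PolyMapF2 s) (k : ℕ → ℕ) where
  /-- planted sampler of side `b` on input `1ⁿ` (instances of size `n + 1`) -/
  samp : Bool → RandAlg ℕ (List Bool)
  /-- the samplers are probabilistic polynomial time -/
  samp_polyTime : ∀ b, (samp b).IsPolyTime unaryEncodeNat (id : List Bool → List Bool)
  /-- its coin budget is this polynomial of the input length (uniformity) -/
  sampCoins : Polynomial ℕ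
  /-- the coin budget is honest -/
  samp_coinLen : ∀ b ℓ, (samp b).coinLen ℓ = sampCoins.eval ℓ
  /-- the planted sampler of side `b` lands in the size-`(n+1)` slice of the orbit of `p_b` -/
  samp_support : ∀ b n, ∀ w ∈ ((samp b).outputPMF unaryEncodeNat n).support,
    w ∈ Side (bySide p₀ p₁ b) k (n + 1)
  /-- in-orbit re-randomiser on instance strings -/
  rer : RandAlg (List Bool) (List Bool)
  /-- the re-randomiser is probabilistic polynomial time -/
  rer_polyTime : rer.IsPolyTime (id : List Bool → List Bool) (id : List Bool → List Bool)
  /-- its coin budget, a polynomial -/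
  rerCoins : Polynomial ℕ
  /-- the coin budget is honest -/
  rer_coinLen : ∀ ℓ, rer.coinLen ℓ = rerCoins.eval ℓ
  /-- the re-randomiser stays inside the orbit slice -/
  rer_side : ∀ b s, ∀ w ∈ Side (bySide p₀ p₁ b) k s, ∀ w' ∈ (rer.outputPMF id w).support,
    w' ∈ Side (bySide p₀ p₁ b) k s
  /-- on every orbit point the law of `rer` is `1/16`-close (one-sided, every event) to the planted law -/
  rer_close : ∀ b n, ∀ w ∈ Side (bySide p₀ p₁ b) k (n + 1), ∀ E : Set (List Bool),
    rer.pr id w E ≤ (samp b).pr unaryEncodeNat n E + 1 / 16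

namespace OrbitKit

variable {p₀ p₁ : (s : ℕ) → PolyMapF2 s} {k : ℕ → ℕ}

/-- The planted law of side `b`: `n ↦` law of `samp b` on `1ⁿ`. [cite: BogdanovTrevisan2006, Def. 2.1] -/
noncomputable def law (kit : OrbitKit p₀ p₁ k) (b : Bool) : Ensemble := fun n =>
  (kit.samp b).outputPMF unaryEncodeNat n

/-- The hard ensemble of the line: the fair mixture of the two planted laws. [cite: BogdanovTrevisan2006, Def. 2.1] -/
noncomputable def mix (kit : OrbitKit p₀ p₁ k) : Ensemble :=
  mixEnsemble (kit.law false) (kit.law true)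

end OrbitKit

/-! ### Glue (§3 of the skeleton) -/

section Glue

variable {p₀ p₁ : (s : ℕ) → PolyMapF2 s} {k : ℕ → ℕ}

/-- `affOut 1 0` is the identity on words of the right length. [folklore] -/
theorem affOut_one_zero {m : ℕ} (l : List (ZMod 2)) (hl : l.length = m) :
    affOut (1 : Matrix (Fin m) (Fin m) (ZMod 2)) 0 l = l := by
  subst hl
  unfold affOut
  rw [Matrix.one_mulVec, add_zero]
  refine List.ext_getElem (by simp) fun i hi hi' => ?_
  rw [List.getElem_ofFn]
  exact (List.getD_eq_getElem _ _ hi').trans rfl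

/-- **Every map lies in its own orbit** (`A = 1`, `b = 0`, `B = 1`, `c = 0`): affine equivalence is
reflexive, so the orbit sets are inhabited by their base points. [folklore] -/
theorem affEquiv_refl {s : ℕ} (P : PolyMapF2 s) : AffEquiv P P := by
  refine ⟨1, 0, 1, 0, isUnit_one, isUnit_one, fun x => ?_⟩
  rw [Matrix.one_mulVec, add_zero, affOut_one_zero _ (PolyMapF2.length_eval P x)]

/-- Affinely equivalent maps have the same output entropy (tree: `PolyMapF2.entropy_eq_of_semiconj`,
`exists_equiv_affineInput`, `affineOutput_injective`). [cite: DvirGutfreundRothblumVadhan2010, §3 p.6] -/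
theorem AffEquiv.entropy_eq {s : ℕ} {P Q : PolyMapF2 s} (h : AffEquiv P Q) :
    Q.entropy = P.entropy := by
  obtain ⟨A, b, B, c, hA, hB, hQ⟩ := h
  obtain ⟨e, he⟩ := exists_equiv_affineInput A hA b
  refine Summit.PneNP.PneNP.Theorems.PolyMapF2.entropy_eq_of_semiconj P Q e (affOut B c)
    (fun a a' haa' => ?_) (fun x => by rw [hQ x, he x])
  have h1 : B.mulVec (fun i : Fin P.length => (P.eval a).getD i 0) + c =
      B.mulVec (fun i : Fin P.length => (P.eval a').getD i 0) + c :=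
    List.ofFn_injective haa'
  have h2 : (fun i : Fin P.length => (P.eval a).getD i 0) =
      (fun i : Fin P.length => (P.eval a').getD i 0) :=
    affineOutput_injective B hB c h1
  refine List.ext_getElem (by simp) fun i hi hi' => ?_
  have hiP : i < P.length := by simpa using hi
  have h3 := congr_fun h2 ⟨i, hiP⟩
  simp only at h3
  rwa [List.getD_eq_getElem _ _ hi, List.getD_eq_getElem _ _ hi'] at h3

/-- YES orbit instances of a separated pair are YES instances of `PEA 3`. [cite: DvirGutfreundRothblumVadhan2010, §3 p.6] -/
theorem orbitSet_yes_subset (hsep : Separated p₀ p₁ k) :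
    OrbitSet p₁ k ⊆ {I : PEAInst | PolyMapF2.DegLE 3 I.2.1 ∧ (I.2.2 : ℝ) + 1 ≤ PolyMapF2.entropy I.2.1} := by
  rintro ⟨s, q, j⟩ ⟨hs, hj, hdeg, haff⟩
  refine ⟨hdeg, ?_⟩
  dsimp only at hs hj hdeg haff ⊢
  rw [hj, haff.entropy_eq]
  exact (hsep s hs).2

/-- NO orbit instances of a separated pair are NO instances of `PEA 3`. [cite: DvirGutfreundRothblumVadhan2010, §3 p.6] -/
theorem orbitSet_no_subset (hsep : Separated p₀ p₁ k) :
    OrbitSet p₀ k ⊆ {I : PEAInst | PolyMapF2.DegLE 3 I.2.1 ∧ PolyMapF2.entropy I.2.1 ≤ (I.2.2 : ℝ)} := by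
  rintro ⟨s, q, j⟩ ⟨hs, hj, hdeg, haff⟩
  refine ⟨hdeg, ?_⟩
  dsimp only at hs hj hdeg haff ⊢
  rw [hj, haff.entropy_eq]
  exact (hsep s hs).1

/-- `OrbitPair.yes ⊆ (PEA 3).yes` for a separated pair. [cite: DvirGutfreundRothblumVadhan2010, §3 p.6] -/
theorem orbitPair_yes_le (hsep : Separated p₀ p₁ k) : (OrbitPair p₀ p₁ k).yes ≤ (PEA 3).yes :=
  PEAInst.encoding.toLanguage_mono (orbitSet_yes_subset hsep)

/-- `OrbitPair.no ⊆ (PEA 3).no` for a separated pair. [cite: DvirGutfreundRothblumVadhan2010, §3 p.6] -/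
theorem orbitPair_no_le (hsep : Separated p₀ p₁ k) : (OrbitPair p₀ p₁ k).no ≤ (PEA 3).no :=
  PEAInst.encoding.toLanguage_mono (orbitSet_no_subset hsep)

/-- **`OrbitPair ≤ₚ PEA 3` by the identity map** (entropy is an orbit invariant). [cite: Goldreich2006, Def. 1.4] -/
theorem orbitPair_polyTimeReducible_PEA (hsep : Separated p₀ p₁ k) :
    (OrbitPair p₀ p₁ k).PolyTimeReducible (PEA 3) :=
  ⟨id, PolyTimeComputable.id _, fun _ hw => orbitPair_yes_le hsep hw,
    fun _ hw => orbitPair_no_le hsep hw⟩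

/-- A separated orbit pair is a disjoint promise problem. [cite: Goldreich2006, Def. 1.1] -/
theorem orbitPair_disjoint (hsep : Separated p₀ p₁ k) : (OrbitPair p₀ p₁ k).Disjoint :=
  Disjoint.mono (orbitPair_yes_le hsep) (orbitPair_no_le hsep) (PEA_disjoint 3)

/-- A size slice of the `p₁`-orbit instances lies in YES. [folklore] -/
theorem side_one_subset_yes (s : ℕ) : Side p₁ k s ⊆ (OrbitPair p₀ p₁ k).yes :=
  PEAInst.encoding.toLanguage_mono fun _ hI => hI.1

/-- A size slice of the `p₀`-orbit instances lies in NO. [folklore] -/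
theorem side_zero_subset_no (s : ℕ) : Side p₀ k s ⊆ (OrbitPair p₀ p₁ k).no :=
  PEAInst.encoding.toLanguage_mono fun _ hI => hI.1

/-- The base instance `⟨s, (pˢ, k s)⟩`, `s ≥ 1`, of a cubic family lies in its own size slice
(`affEquiv_refl`): the slices the planted samplers live on are inhabited. [folklore] -/
theorem encode_base_mem_side (p : (s : ℕ) → PolyMapF2 s) (k : ℕ → ℕ) {s : ℕ} (hs : 1 ≤ s)
    (hdeg : (p s).DegLE 3) : PEAInst.encoding.encode ⟨s, (p s, k s)⟩ ∈ Side p k s :=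
  ⟨⟨s, (p s, k s)⟩, ⟨⟨hs, rfl, hdeg, affEquiv_refl _⟩, rfl⟩, rfl⟩

namespace OrbitKit

/-- The planted laws are polynomial-time samplable (by their very samplers). [cite: BogdanovTrevisan2006, Def. 2.1] -/
theorem isPolySamplable_law (kit : OrbitKit p₀ p₁ k) (b : Bool) : (kit.law b).IsPolySamplable :=
  ⟨kit.samp b, kit.samp_polyTime b, fun _ => rfl⟩

/-- The mixture is polynomial-time samplable (tree: `Ensemble.isPolySamplable_mixEnsemble`).
[cite: BogdanovTrevisan2006, Def. 2.1] -/
theorem isPolySamplable_mix (kit : OrbitKit p₀ p₁ k) : kit.mix.IsPolySamplable :=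
  Ensemble.isPolySamplable_mixEnsemble (kit.isPolySamplable_law false) (kit.isPolySamplable_law true)

/-- The planted law of side `false` lives on NO instances. [folklore] -/
theorem law_false_support (kit : OrbitKit p₀ p₁ k) (n : ℕ) (w : List Bool)
    (hw : w ∈ (kit.law false n).support) : w ∈ (OrbitPair p₀ p₁ k).no :=
  side_zero_subset_no (n + 1) (kit.samp_support false n w hw)

/-- The planted law of side `true` lives on YES instances. [folklore] -/
theorem law_true_support (kit : OrbitKit p₀ p₁ k) (n : ℕ) (w : List Bool)
    (hw : w ∈ (kit.law true n).support) : w ∈ (OrbitPair p₀ p₁ k).yes :=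
  side_one_subset_yes (n + 1) (kit.samp_support true n w hw)

/-- The mixture is supported on the promise of `OrbitPair`. [cite: BogdanovTrevisan2006, Def. 2.1] -/
theorem mix_support (kit : OrbitKit p₀ p₁ k) (n : ℕ) (w : List Bool) (hw : w ∈ (kit.mix n).support) :
    w ∈ (OrbitPair p₀ p₁ k).yes ∨ w ∈ (OrbitPair p₀ p₁ k).no := by
  rcases (mem_support_mixEnsemble_iff _ _ n w).1 hw with h | h
  · exact Or.inr (kit.law_false_support n w h)
  · exact Or.inl (kit.law_true_support n w h)

end OrbitKit

end Glue

end Summit.PneNP.PneNP.Cruxes.PeaWorstToAvg.OrbitPairRsr
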